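import Literature.MathematicalPhysics.QuantumFieldTheory.Federbush1986.AbelianEstimatesLe

/-!
# `Federbush1986.AbelianEstimatesSect4` — [Federbush1986PhaseCellI] §4 pp. 328–329 «Some Proofs»: the five «easy
# implications» among Estimates 0.1–0.7, PROVED for the `≤` readings of `AbelianEstimatesLe`, with explicit constants; (4.1)

statement-level skeleton of published theorems with citation tags; proofs where landed; nothing here is a claim about the Yang–Mills mass gap

CITATION HEADER.  P. Federbush, *A phase cell approach to Yang–Mills theory. I*, Commun. Math. Phys. **107** (1986) 319–329
[Federbush1986PhaseCellI] (renders `run/shared/lean/pub/lit-balaban/lit-balaban-r17/renders/fedI/fed1986-cmp107-p010-x2.png`,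
`-p011-x2.png` re-read AS IMAGES).  §4 pp. 328–329, verbatim: *«We begin with some easy implications.  Estimate 0.5 ⇒ Estimate
0.6, immediate.  Estimate 0.2 ⇒ Estimate 0.6, using (1.14).  (2.13) and (3.13) ⇒ Estimate 0.4, immediate.  (2.15) and (3.14) ⇒
Estimate 0.5, immediate.  Estimate 0.3 ⇒ Estimate 0.7, using (1.14).»*; p. 329: *«By (2.13) and (3.13) we have |A^N(e)| <
ce^{−γd(e,0)}. (4.1)»*; §0 pp. 320–321, (1.13)–(1.14) p. 324, (2.13)–(2.15) p. 326, §3 p. 327 *«By scaling arguments it is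
enough to study level 0 modes … By translation invariance and linearity …»*.  Unit `lit-balaban-p04` gen 6; SKELETON row
**F1.Eq4.1-4.6** of `run/shared/lean/pub/lit-balaban/lit-balaban-r17/SKELETON-r17.md` (fold owner r17); uses r17's
`LatticeActionLimit` (`plaqFunctional_eq_plaqAvg` = Green for (1.13), `abs_plaqAvg_le`, `plaqAvg_sub`).

THE MATHEMATICS (for the `≤` predicates of `AbelianEstimatesLe`; constants explicit, uniform in `r₀`, `L ≥ ℓ_{r₀}`, `z`, `|A(m)|`
and the field; `0 ≤ γ`, `ℓ_{r₀} ≤ L` let the weight `e^{−γ|·−z|/L}` be re-centred by `≤ 4L` resp. `κL` at the cost `e^{4γ}`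
resp. `e^{γκ}`):  «0.5 ⇒ 0.6»: `A_{∂p} = [A(e₁) − A(e₃)] − [A(e₄) − A(e₂)]`, two pairs of ADJACENT parallel edges at distance
`ℓ` based at the corner of `p`; needs `ℓ_{r₀} < c₁L`; constant `2c`.  «0.2 ⇒ 0.6 using (1.14)»: by Green, `A_{∂p}` is the
average of `F_{μν}` over sample points within `4ℓ` of `src p`, times `ℓ²`, once the plaquette assignments ARE the functional
(1.13)–(1.14) (hypothesis `D.plaq s A = plaqFunctional s A`, the typed `PlaquetteAssignmentsEq114` for the field, §2);
constant `2e^{4γ}c`.  «(2.13) and (3.13) ⇒ 0.4»: (3.13) is Estimate 0.1 of the level-0 single-bond mode; in the typed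
(scaled, translated) vocabulary (2.13) ∧ Estimate 0.1 ⇒ Estimate 0.4, `|A(e)| ≤ κℓ sup_{d(x,e)<κℓ}|A_μ| ≤
κℓ·cL⁻¹e^{γκ}e^{−γd(e,z)/L}|A(m)|`, constant `κ⁺e^{γκ⁺}c` (`κ` the constant of (2.13)); at level 0 this is **(4.1)**.
«(2.15) and (3.14) ⇒ 0.5»: likewise, region constant `κ`, bound constant `κ⁺e^{γκ⁺}c` — at the levels with `ℓ_s < L` ONLY,
because (2.14) requires «L > ℓ(e₁)» (READING NOTE: for `L = ℓ_{r₀}` the level `r₀`, where the bond assignments are the data,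
is not delivered by (2.15)).  «0.3 ⇒ 0.7 using (1.14)»: `A_{∂p₁} − A_{∂p₂} = ∫∫∫[F_{μν}(y) − F_{μν}(y + v)]`, `|v| = d(p₁,p₂) <
cL`, with (0.4) at the pairs `(y, y+v)`; `c_ε ↦ 2e^{4γ}c_ε`.  §0: the strict typing fails for EVERY datum (`not_estimate05_
conjunct`); §3 ports the fold owner's row F1.Sect§4 theorem to the `≤` hypotheses.  Theorems only; axioms standard.
-/

namespace Literature.MathematicalPhysics.QuantumFieldTheory.Federbush1986

open MeasureTheory Filter Set

namespace AbelianAveraging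

variable {D : AbelianAveraging}

/-! ## §0 The strict typing fails for every datum (not only `a = 0`) -/

/-- For EVERY datum `a` — in particular print's «single configuration … having exactly one non-zero value» (p. 327) — the
Estimate-0.5 conjunct of the typed `ModeEstimates` (strict (0.7), `c > 0`, `L = ℓ_{r₀}`) is unsatisfiable at `e₁ = e₂`: the
refutation `not_modeEstimates` does not hinge on the zero datum. [cite: Federbush1986PhaseCellI, Estimate 0.5 (0.7)–(0.8)
p. 320; §3 p. 327] -/
theorem not_estimate05_conjunct {c : ℝ} (hc : 0 < c) (γ : ℝ) (r₀ : ℕ) (z : E4) (a : Edge r₀ → ℝ)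
    (A : E4 → Fin 4 → ℝ) : ¬ D.Estimate05 r₀ c γ (latLen r₀) z (maxAssign a) A :=
  D.not_estimate05_self (mul_pos hc (latLen_pos r₀)) r₀ γ z (maxAssign a) A

/-! ## §1 The five «easy implications» of §4 p. 328–329 (constants explicit) -/

/-- **«Estimate 0.5 ⇒ Estimate 0.6, immediate.»** (for the `≤` readings): if adjacent parallel edges are in the region (0.8)
(`ℓ_{r₀} < c₁L`), then Estimate 0.5 with bound constant `c` gives Estimate 0.6 with constant `2c`, via
`A_{∂p} = [A(e₁) − A(e₃)] − [A(e₄) − A(e₂)]`. [cite: Federbush1986PhaseCellI, §4 p. 328] -/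
theorem estimate06Le_of_estimate05Le {r₀ : ℕ} {c₁ c γ L : ℝ} {z : E4} {Am : ℝ} {A : E4 → Fin 4 → ℝ}
    (hL : latLen r₀ < c₁ * L) (h5 : D.Estimate05Le r₀ c₁ c γ L z Am A) :
    D.Estimate06Le r₀ (2 * c) γ L z Am A := by
  intro s hs p
  have hl : latLen s < c₁ * L := (latLen_le_of_le hs).trans_lt hL
  have hd₁ : dist (⟨p.base, p.dir₁⟩ : Edge s).src (⟨p.base + Pi.single p.dir₂ 1, p.dir₁⟩ : Edge s).src = latLen s :=
    dist_src_shift _ _ _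
  have hd₂ : dist (⟨p.base, p.dir₂⟩ : Edge s).src (⟨p.base + Pi.single p.dir₁ 1, p.dir₂⟩ : Edge s).src = latLen s :=
    dist_src_shift _ _ _
  have b₁ := h5 s hs ⟨p.base, p.dir₁⟩ ⟨p.base + Pi.single p.dir₂ 1, p.dir₁⟩ rfl (by rwa [hd₁])
  have b₂ := h5 s hs ⟨p.base, p.dir₂⟩ ⟨p.base + Pi.single p.dir₁ 1, p.dir₂⟩ rfl (by rwa [hd₂])
  rw [hd₁, show (⟨p.base, p.dir₁⟩ : Edge s).src = p.src from rfl] at b₁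
  rw [hd₂, show (⟨p.base, p.dir₂⟩ : Edge s).src = p.src from rfl] at b₂
  unfold plaq
  rw [plaqOfBonds_eq_sub_sub]
  refine ((abs_sub _ _).trans (add_le_add b₁ b₂)).trans_eq ?_
  ring

/-- **«Estimate 0.2 ⇒ Estimate 0.6, using (1.14).»** (for the `≤` readings): if the level-`s` plaquette assignments of the
`C¹` field `A` ARE the functional (1.13)–(1.14) (hypothesis `h114`, the typed `PlaquetteAssignmentsEq114` for `A`), then by
Green `A_{∂p}` is the average of `F_{μν} = ∂_μA_ν − ∂_νA_μ` over sample points within `4ℓ` of `src p`, times `ℓ²`; so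
Estimate 0.2 (constant `c`) gives Estimate 0.6 with constant `2e^{4γ}c` (`γ ≥ 0`, `ℓ_{r₀} ≤ L`).
[cite: Federbush1986PhaseCellI, §4 p. 328; (1.13)–(1.14) p. 324] -/
theorem estimate06Le_of_estimate02Le {r₀ : ℕ} {c γ L : ℝ} {z : E4} {Am : ℝ} {A : E4 → Fin 4 → ℝ}
    (hA : ContDiff ℝ 1 A) (hγ : 0 ≤ γ) (hL : latLen r₀ ≤ L)
    (h114 : ∀ s, r₀ ≤ s → ∀ p : Plaq s, D.plaq s A p = plaqFunctional s A p)
    (h2 : Estimate02Le c γ L z Am A) :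
    D.Estimate06Le r₀ (2 * Real.exp (4 * γ) * c) γ L z Am A := by
  intro s hs p
  have hLpos : 0 < L := (latLen_pos r₀).trans_le hL
  have hl : latLen s ≤ L := (latLen_le_of_le hs).trans hL
  have hcoef : 0 ≤ c / L ^ 2 * Am := h2.coeff_nonneg
  rw [h114 s hs p, plaqFunctional_eq_plaqAvg hA p]
  set M : ℝ := 2 * (c / L ^ 2 * Am * (Real.exp (4 * γ) * Real.exp (-γ * dist p.src z / L))) with hM
  have key : ∀ y : E4, dist y p.src ≤ 4 * latLen s → |fieldStrength A p.dir₁ p.dir₂ y| ≤ M := by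
    intro y hy
    have hy' : dist y p.src ≤ 4 * L := hy.trans (by gcongr)
    have hexp := exp_weight_le (z := z) hγ hLpos hy'
    rw [mul_comm γ 4] at hexp
    calc |fieldStrength A p.dir₁ p.dir₂ y| = |pd A p.dir₁ p.dir₂ y - pd A p.dir₂ p.dir₁ y| := rfl
      _ ≤ |pd A p.dir₁ p.dir₂ y| + |pd A p.dir₂ p.dir₁ y| := abs_sub _ _
      _ ≤ c / L ^ 2 * Real.exp (-γ * dist y z / L) * Am + c / L ^ 2 * Real.exp (-γ * dist y z / L) * Am :=
          add_le_add (h2 y _ _) (h2 y _ _)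
      _ = 2 * (c / L ^ 2 * Am * Real.exp (-γ * dist y z / L)) := by ring
      _ ≤ M := by rw [hM]; gcongr
  have hbound := abs_plaqAvg_le (fieldStrength A p.dir₁ p.dir₂) p.src p.dir₁ p.dir₂ (latLen_pos s).le (M := M)
    (fun u hu σ hσ τ hτ => key _ (dist_samplePt_le (latLen_pos s).le p.src hu hσ hτ _ _))
  calc |plaqAvg (fieldStrength A p.dir₁ p.dir₂) p.src p.dir₁ p.dir₂ (latLen s)| ≤ M * latLen s ^ 2 := hbound
    _ = 2 * Real.exp (4 * γ) * c * (latLen s / L) ^ 2 * Real.exp (-γ * dist p.src z / L) * Am := by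
        rw [hM]; field_simp

/-- **«(2.13) and (3.13) ⇒ Estimate 0.4, immediate.»** (for the `≤` readings, (3.13) in its scaled and translated form =
Estimate 0.1, cf. p. 327 «By scaling arguments it is enough to study level 0 modes … By translation invariance and
linearity …»): if the bond assignments obey (2.13) with constant `κ` then Estimate 0.1 (constant `c`, `γ ≥ 0`, `ℓ_{r₀} ≤ L`)
gives Estimate 0.4 with constant `κ⁺e^{γκ⁺}c`, `κ⁺ = max κ 0`: `|A(e)| ≤ κℓ sup_{d(x,e)<κℓ}|A_μ(x)| ≤ κℓ·cL⁻¹e^{γκ}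
e^{−γd(e,z)/L}|A(m)|`. [cite: Federbush1986PhaseCellI, §4 p. 329; (2.13) p. 326] -/
theorem estimate04Le_of_eq213_of_estimate01Le {κ : ℝ}
    (h213 : ∀ (A : E4 → Fin 4 → ℝ) (B₁ B₂ : ℝ), ContDiff ℝ 1 A → (∀ x μ, |A x μ| ≤ B₁) →
      (∀ x ν μ, |pd A ν μ x| ≤ B₂) →
        ∀ s (e : Edge s), |D.bond s A e| ≤ κ * latLen s * ⨆ x : Metric.ball e.src (κ * latLen s), ⨆ μ, |A x μ|)
    {r₀ : ℕ} {c γ L : ℝ} {z : E4} {Am : ℝ} {A : E4 → Fin 4 → ℝ} {B₁ B₂ : ℝ}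
    (hA : ContDiff ℝ 1 A) (hB₁ : ∀ x μ, |A x μ| ≤ B₁) (hB₂ : ∀ x ν μ, |pd A ν μ x| ≤ B₂)
    (hγ : 0 ≤ γ) (hL : latLen r₀ ≤ L) (h1 : Estimate01Le c γ L z Am A) :
    D.Estimate04Le r₀ (max κ 0 * Real.exp (γ * max κ 0) * c) γ L z Am A := by
  intro s hs e
  have hLpos : 0 < L := (latLen_pos r₀).trans_le hL
  have hl : latLen s ≤ L := (latLen_le_of_le hs).trans hL
  have hlpos : 0 < latLen s := latLen_pos s
  have hκ : κ ≤ max κ 0 := le_max_left _ _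
  have hκ0 : 0 ≤ max κ 0 := le_max_right _ _
  have hcoef : 0 ≤ c * (1 / L) * Am := h1.coeff_nonneg
  set M : ℝ := c * (1 / L) * Am * (Real.exp (γ * max κ 0) * Real.exp (-γ * dist e.src z / L)) with hM
  have hM0 : 0 ≤ M := by rw [hM]; positivity
  -- the supremum over the ball is at most `M`
  have hS : (⨆ x : Metric.ball e.src (κ * latLen s), ⨆ μ, |A x μ|) ≤ M := by
    refine Real.iSup_le (fun x => Real.iSup_le (fun μ => ?_) hM0) hM0
    have hx : dist (x : E4) e.src ≤ max κ 0 * L := by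
      have := (Metric.mem_ball.1 x.2).le
      exact this.trans (mul_le_mul hκ hl hlpos.le hκ0)
    have hexp := exp_weight_le (z := z) hγ hLpos hx
    calc |A x μ| ≤ c * (1 / L) * Real.exp (-γ * dist (x : E4) z / L) * Am := h1 x μ
      _ = c * (1 / L) * Am * Real.exp (-γ * dist (x : E4) z / L) := by ring
      _ ≤ M := by rw [hM]; gcongr
  have hS0 : 0 ≤ ⨆ x : Metric.ball e.src (κ * latLen s), ⨆ μ, |A x μ| :=
    Real.iSup_nonneg fun _ => Real.iSup_nonneg fun _ => abs_nonneg _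
  calc |D.bond s A e| ≤ κ * latLen s * ⨆ x : Metric.ball e.src (κ * latLen s), ⨆ μ, |A x μ| :=
        h213 A B₁ B₂ hA hB₁ hB₂ s e
    _ ≤ max κ 0 * latLen s * ⨆ x : Metric.ball e.src (κ * latLen s), ⨆ μ, |A x μ| := by gcongr
    _ ≤ max κ 0 * latLen s * M := by gcongr
    _ = max κ 0 * Real.exp (γ * max κ 0) * c * (latLen s / L) * Real.exp (-γ * dist e.src z / L) * Am := by
        rw [hM]; ring

/-- The same with the typed `Eq213` (existential constant): (2.13) ∧ Estimate 0.1 ⇒ Estimate 0.4 with SOME constant `c' ≥ 0`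
depending only on the carrier and on `γ` (uniform in `r₀`, `L ≥ ℓ_{r₀}`, `z`, `|A(m)|`, the field and its constant `c`, which
enters linearly). [cite: Federbush1986PhaseCellI, §4 p. 329; (2.13) p. 326] -/
theorem estimate04Le_of_eq213 (h213 : D.Eq213) {γ : ℝ} (hγ : 0 ≤ γ) :
    ∃ c' : ℝ, 0 ≤ c' ∧ ∀ (r₀ : ℕ) (c L : ℝ) (z : E4) (Am : ℝ) (A : E4 → Fin 4 → ℝ) (B₁ B₂ : ℝ),
      ContDiff ℝ 1 A → (∀ x μ, |A x μ| ≤ B₁) → (∀ x ν μ, |pd A ν μ x| ≤ B₂) → latLen r₀ ≤ L →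
        Estimate01Le c γ L z Am A → D.Estimate04Le r₀ (c' * c) γ L z Am A := by
  obtain ⟨κ, hκ⟩ := h213
  exact ⟨max κ 0 * Real.exp (γ * max κ 0), by positivity, fun r₀ c L z Am A B₁ B₂ hA hB₁ hB₂ hL h1 =>
    estimate04Le_of_eq213_of_estimate01Le hκ hA hB₁ hB₂ hγ hL h1⟩

/-- **«(2.15) and (3.14) ⇒ Estimate 0.5, immediate.»** (for the `≤` readings, (3.14) in its scaled and translated form =
Estimate 0.2): if the bond assignments obey (2.15) with constant `κ` then Estimate 0.2 (constant `c`, `γ ≥ 0`) gives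
Estimate 0.5 with region constant `κ` and bound constant `κ⁺e^{γκ⁺}c` — at the levels `s ≥ r₁` with `ℓ_{r₁} < L`.
READING NOTE: (2.14) requires «L > ℓ(e₁)», so for `L = ℓ_{r₀}` the printed implication delivers Estimate 0.5 at the levels
`s > r₀` only (`r₁ = r₀ + 1`); at the level `r₀` itself the bond assignments are the prescribed data.
[cite: Federbush1986PhaseCellI, §4 p. 329; (2.14)–(2.15) p. 326] -/
theorem estimate05Le_of_eq215_of_estimate02Le {κ : ℝ}
    (h215 : ∀ (A : E4 → Fin 4 → ℝ) (B₁ B₂ : ℝ), ContDiff ℝ 1 A → (∀ x μ, |A x μ| ≤ B₁) →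
      (∀ x ν μ, |pd A ν μ x| ≤ B₂) →
        ∀ s (e₁ e₂ : Edge s) (L : ℝ), e₁.dir = e₂.dir → dist e₁.src e₂.src < κ * L → latLen s < L →
          |D.bond s A e₁ - D.bond s A e₂|
            ≤ κ * dist e₁.src e₂.src * latLen s * ⨆ x : Metric.ball e₁.src (κ * L), ⨆ ν, ⨆ μ, |pd A ν μ x|)
    {r₁ : ℕ} {c γ L : ℝ} {z : E4} {Am : ℝ} {A : E4 → Fin 4 → ℝ} {B₁ B₂ : ℝ}
    (hA : ContDiff ℝ 1 A) (hB₁ : ∀ x μ, |A x μ| ≤ B₁) (hB₂ : ∀ x ν μ, |pd A ν μ x| ≤ B₂)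
    (hγ : 0 ≤ γ) (hL : latLen r₁ < L) (h2 : Estimate02Le c γ L z Am A) :
    D.Estimate05Le r₁ κ (max κ 0 * Real.exp (γ * max κ 0) * c) γ L z Am A := by
  intro s hs e₁ e₂ hdir hd
  have hLpos : 0 < L := (latLen_pos r₁).trans hL
  have hl : latLen s < L := (latLen_le_of_le hs).trans_lt hL
  have hlpos : 0 < latLen s := latLen_pos s
  have hκ : κ ≤ max κ 0 := le_max_left _ _
  have hκ0 : 0 ≤ max κ 0 := le_max_right _ _
  have hcoef : 0 ≤ c / L ^ 2 * Am := h2.coeff_nonneg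
  set M : ℝ := c / L ^ 2 * Am * (Real.exp (γ * max κ 0) * Real.exp (-γ * dist e₁.src z / L)) with hM
  have hM0 : 0 ≤ M := by rw [hM]; positivity
  have hS : (⨆ x : Metric.ball e₁.src (κ * L), ⨆ ν, ⨆ μ, |pd A ν μ x|) ≤ M := by
    refine Real.iSup_le (fun x => Real.iSup_le (fun ν => Real.iSup_le (fun μ => ?_) hM0) hM0) hM0
    have hx : dist (x : E4) e₁.src ≤ max κ 0 * L := (Metric.mem_ball.1 x.2).le.trans (mul_le_mul_of_nonneg_right hκ hLpos.le)
    have hexp := exp_weight_le (z := z) hγ hLpos hx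
    calc |pd A ν μ x| ≤ c / L ^ 2 * Real.exp (-γ * dist (x : E4) z / L) * Am := h2 x ν μ
      _ = c / L ^ 2 * Am * Real.exp (-γ * dist (x : E4) z / L) := by ring
      _ ≤ M := by rw [hM]; gcongr
  have hS0 : 0 ≤ ⨆ x : Metric.ball e₁.src (κ * L), ⨆ ν, ⨆ μ, |pd A ν μ x| :=
    Real.iSup_nonneg fun _ => Real.iSup_nonneg fun _ => Real.iSup_nonneg fun _ => abs_nonneg _
  calc |D.bond s A e₁ - D.bond s A e₂|
      ≤ κ * dist e₁.src e₂.src * latLen s * ⨆ x : Metric.ball e₁.src (κ * L), ⨆ ν, ⨆ μ, |pd A ν μ x| :=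
        h215 A B₁ B₂ hA hB₁ hB₂ s e₁ e₂ L hdir hd hl
    _ ≤ max κ 0 * dist e₁.src e₂.src * latLen s * ⨆ x : Metric.ball e₁.src (κ * L), ⨆ ν, ⨆ μ, |pd A ν μ x| := by
        gcongr
    _ ≤ max κ 0 * dist e₁.src e₂.src * latLen s * M := by gcongr
    _ = max κ 0 * Real.exp (γ * max κ 0) * c * (latLen s / L) * (dist e₁.src e₂.src / L)
          * Real.exp (-γ * dist e₁.src z / L) * Am := by
        rw [hM]; ring

/-- The same with the typed `Eq215` (existential constant): (2.15) ∧ Estimate 0.2 ⇒ Estimate 0.5 at the levels with `ℓ_s < L`,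
with SOME region constant `c₁` and bound constant `c' c`, `c' ≥ 0`, depending only on the carrier and on `γ`.
[cite: Federbush1986PhaseCellI, §4 p. 329; (2.14)–(2.15) p. 326] -/
theorem estimate05Le_of_eq215 (h215 : D.Eq215) {γ : ℝ} (hγ : 0 ≤ γ) :
    ∃ c₁ c' : ℝ, 0 ≤ c' ∧ ∀ (r₁ : ℕ) (c L : ℝ) (z : E4) (Am : ℝ) (A : E4 → Fin 4 → ℝ) (B₁ B₂ : ℝ),
      ContDiff ℝ 1 A → (∀ x μ, |A x μ| ≤ B₁) → (∀ x ν μ, |pd A ν μ x| ≤ B₂) → latLen r₁ < L →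
        Estimate02Le c γ L z Am A → D.Estimate05Le r₁ c₁ (c' * c) γ L z Am A := by
  obtain ⟨κ, hκ⟩ := h215
  exact ⟨κ, max κ 0 * Real.exp (γ * max κ 0), by positivity, fun r₁ c L z Am A B₁ B₂ hA hB₁ hB₂ hL h2 =>
    estimate05Le_of_eq215_of_estimate02Le hκ hA hB₁ hB₂ hγ hL h2⟩

/-- Two plaquettes of `ℒ^s` with the same directions and the same corner are equal. [cite: Federbush1986PhaseCellI, Fig. 4
p. 324] -/
theorem Plaq.eq_of_src_eq {s : ℕ} {p₁ p₂ : Plaq s} (h : p₁.src = p₂.src) (h₁ : p₁.dir₁ = p₂.dir₁)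
    (h₂ : p₁.dir₂ = p₂.dir₂) : p₁ = p₂ := by
  have hb : p₁.base = p₂.base := by
    funext k
    have hk := congrArg (fun q : E4 => q k) h
    simp only [Plaq.src, mkPt, PiLp.toLp_apply] at hk
    exact_mod_cast (mul_right_injective₀ (latLen_pos s).ne' hk)
  cases p₁; cases p₂; simp only at hb h₁ h₂; subst hb; subst h₁; subst h₂; rfl

/-- **«Estimate 0.3 ⇒ Estimate 0.7, using (1.14).»** (for the `≤` readings): under `h114` (the plaquette assignments of the
`C¹` field `A` are the functional (1.13)–(1.14)), `A_{∂p₁} − A_{∂p₂} = ∫_{u}∫₀^ℓ∫₀^ℓ [F_{μν}(y) − F_{μν}(y + v)]` with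
`v = src p₂ − src p₁`, `|v| = d(p₁,p₂) < cL`, and the Hölder bound (0.4) at the pairs `(y, y+v)`, `y` within `4ℓ ≤ 4L` of
`src p₁`, gives Estimate 0.7 with `c_ε ↦ 2e^{4γ}c_ε` and the same region constant (`γ ≥ 0`, `ℓ_{r₀} ≤ L`).
[cite: Federbush1986PhaseCellI, §4 p. 329; (1.13)–(1.14) p. 324] -/
theorem estimate07Le_of_estimate03Le {r₀ : ℕ} {c γ L : ℝ} {cε : ℝ → ℝ} {z : E4} {Am : ℝ} {A : E4 → Fin 4 → ℝ}
    (hA : ContDiff ℝ 1 A) (hγ : 0 ≤ γ) (hL : latLen r₀ ≤ L)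
    (h114 : ∀ s, r₀ ≤ s → ∀ p : Plaq s, D.plaq s A p = plaqFunctional s A p)
    (h3 : Estimate03Le c γ L cε z Am A) :
    D.Estimate07Le r₀ c γ L (fun ε => 2 * Real.exp (4 * γ) * cε ε) z Am A := by
  intro ε hε s hs p₁ p₂ hd₁ hd₂ hd
  beta_reduce
  have hLpos : 0 < L := (latLen_pos r₀).trans_le hL
  have hl : latLen s ≤ L := (latLen_le_of_le hs).trans hL
  have hlpos : 0 < latLen s := latLen_pos s
  have hcL : 0 < c * L := dist_nonneg.trans_lt hd
  have hLε : 0 < L ^ (3 - ε) := Real.rpow_pos_of_pos hLpos _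
  -- the amplitude `cε ε · |A(m)|` is effectively non-negative: test (0.4) at the pair `(z, z + (cL/2)u₀)`
  have hcoef : 0 ≤ cε ε * Am := by
    set w : E4 := z + (c * L / 2) • unitVec 0 with hw
    have hnu : ‖(unitVec 0 : E4)‖ = 1 := by unfold unitVec; simp
    have hzw : dist z w = c * L / 2 := by
      rw [hw, dist_self_add_right, norm_smul, hnu, mul_one, Real.norm_of_nonneg (by positivity)]
    have hne : z ≠ w := by
      intro hzw'
      rw [← dist_eq_zero, hzw] at hzw'
      linarith
    have h' := h3 ε hε z w 0 0 hne (by rw [hzw]; linarith)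
    rw [dist_self, mul_zero, zero_div, Real.exp_zero, mul_one] at h'
    have h0 : 0 ≤ cε ε / L ^ (3 - ε) * Am := (div_nonneg (abs_nonneg _) (Real.rpow_nonneg dist_nonneg _)).trans h'
    have : cε ε / L ^ (3 - ε) * Am = (cε ε * Am) / L ^ (3 - ε) := by ring
    rw [this] at h0
    exact (div_nonneg_iff.1 h0).elim (fun h => h.1) (fun h => absurd h.2 (not_le.2 hLε))
  by_cases hsrc : p₁.src = p₂.src
  · -- degenerate pair: `p₁ = p₂`
    have hp : p₁ = p₂ := Plaq.eq_of_src_eq hsrc hd₁ hd₂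
    subst hp
    rw [sub_self, abs_zero]
    have : 0 ≤ dist p₁.src p₁.src ^ (1 - ε) := Real.rpow_nonneg dist_nonneg _
    calc (0 : ℝ) ≤ (2 * Real.exp (4 * γ) * (latLen s ^ 2 / L ^ (3 - ε)) * Real.exp (-γ * dist p₁.src z / L))
          * dist p₁.src p₁.src ^ (1 - ε) * (cε ε * Am) := by positivity
      _ = _ := by ring
  -- generic pair
  set v : E4 := p₂.src - p₁.src with hv
  have hv' : p₂.src = p₁.src + v := by rw [hv]; abel
  have hvn : ‖v‖ = dist p₁.src p₂.src := by rw [hv, dist_eq_norm, norm_sub_rev]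
  have hv0 : v ≠ 0 := by
    intro h0
    exact hsrc (by rw [hv', h0, add_zero])
  have hdpos : 0 < dist p₁.src p₂.src := dist_pos.2 hsrc
  have hdε : 0 < dist p₁.src p₂.src ^ (1 - ε) := Real.rpow_pos_of_pos hdpos _
  set F : E4 → ℝ := fieldStrength A p₁.dir₁ p₁.dir₂ with hF
  have hFc : Continuous F := continuous_fieldStrength hA _ _
  have hFvc : Continuous fun y => F (y + v) := hFc.comp (continuous_id.add continuous_const)
  have hlhs : D.plaq s A p₁ - D.plaq s A p₂
      = plaqAvg (fun y => F y - F (y + v)) p₁.src p₁.dir₁ p₁.dir₂ (latLen s) := by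
    rw [h114 s hs p₁, h114 s hs p₂, plaqFunctional_eq_plaqAvg hA p₁, plaqFunctional_eq_plaqAvg hA p₂, ← hd₁, ← hd₂,
      hv', ← plaqAvg_comp_add, ← plaqAvg_sub hFc hFvc]
  rw [hlhs]
  set M : ℝ := 2 * (cε ε * Am / L ^ (3 - ε) * dist p₁.src p₂.src ^ (1 - ε)
      * (Real.exp (4 * γ) * Real.exp (-γ * dist p₁.src z / L))) with hM
  have key : ∀ y : E4, dist y p₁.src ≤ 4 * latLen s → |F y - F (y + v)| ≤ M := by
    intro y hy
    have hy' : dist y p₁.src ≤ 4 * L := hy.trans (by gcongr)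
    have hexp := exp_weight_le (z := z) hγ hLpos hy'
    rw [mul_comm γ 4] at hexp
    have hne : y ≠ y + v := by
      intro h; exact hv0 (by simpa using h.symm)
    have hdy : dist y (y + v) = dist p₁.src p₂.src := by rw [dist_self_add_right, hvn]
    have hq : ∀ ν μ, |pd A ν μ y - pd A ν μ (y + v)|
        ≤ cε ε * Am / L ^ (3 - ε) * dist p₁.src p₂.src ^ (1 - ε) * Real.exp (-γ * dist y z / L) := by
      intro ν μ
      have h' := h3 ε hε y (y + v) ν μ hne (by rw [hdy]; exact hd)
      rw [hdy, div_le_iff₀ hdε] at h'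
      calc _ ≤ cε ε / L ^ (3 - ε) * Real.exp (-γ * dist y z / L) * Am * dist p₁.src p₂.src ^ (1 - ε) := h'
        _ = _ := by ring
    calc |F y - F (y + v)|
        = |(pd A p₁.dir₁ p₁.dir₂ y - pd A p₁.dir₁ p₁.dir₂ (y + v))
            - (pd A p₁.dir₂ p₁.dir₁ y - pd A p₁.dir₂ p₁.dir₁ (y + v))| := by
          rw [hF]; unfold fieldStrength; ring_nf
      _ ≤ |pd A p₁.dir₁ p₁.dir₂ y - pd A p₁.dir₁ p₁.dir₂ (y + v)|
            + |pd A p₁.dir₂ p₁.dir₁ y - pd A p₁.dir₂ p₁.dir₁ (y + v)| := abs_sub _ _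
      _ ≤ cε ε * Am / L ^ (3 - ε) * dist p₁.src p₂.src ^ (1 - ε) * Real.exp (-γ * dist y z / L)
            + cε ε * Am / L ^ (3 - ε) * dist p₁.src p₂.src ^ (1 - ε) * Real.exp (-γ * dist y z / L) :=
          add_le_add (hq _ _) (hq _ _)
      _ = 2 * (cε ε * Am / L ^ (3 - ε) * dist p₁.src p₂.src ^ (1 - ε) * Real.exp (-γ * dist y z / L)) := by ring
      _ ≤ M := by
          rw [hM]
          have : 0 ≤ cε ε * Am / L ^ (3 - ε) * dist p₁.src p₂.src ^ (1 - ε) := by positivity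
          gcongr
  have hbound := abs_plaqAvg_le (fun y => F y - F (y + v)) p₁.src p₁.dir₁ p₁.dir₂ hlpos.le (M := M)
    (fun u hu σ hσ τ hτ => key _ (dist_samplePt_le hlpos.le p₁.src hu hσ hτ _ _))
  calc |plaqAvg (fun y => F y - F (y + v)) p₁.src p₁.dir₁ p₁.dir₂ (latLen s)| ≤ M * latLen s ^ 2 := hbound
    _ = 2 * Real.exp (4 * γ) * cε ε * dist p₁.src p₂.src ^ (1 - ε) * (latLen s ^ 2 / L ^ (3 - ε))
          * Real.exp (-γ * dist p₁.src z / L) * Am := by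
        rw [hM]; ring

/-! ## §2 Supplying the hypothesis «(1.14)» from the typed `PlaquetteAssignmentsEq114`, and (4.1) -/

/-- «0.2 ⇒ 0.6 using (1.14)» with (1.14) supplied by the typed `PlaquetteAssignmentsEq114` and the bounds (2.3)–(2.4) by
Estimates 0.1–0.2 themselves. [cite: Federbush1986PhaseCellI, §4 p. 328; (1.13)–(1.14) p. 324] -/
theorem estimate06Le_of_eq114_of_estimate02Le (h114 : D.PlaquetteAssignmentsEq114) {r₀ : ℕ} {c γ L : ℝ} {z : E4}
    {Am : ℝ} {A : E4 → Fin 4 → ℝ} (hA : ContDiff ℝ 1 A) (hγ : 0 ≤ γ) (hL : latLen r₀ ≤ L)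
    (h1 : Estimate01Le c γ L z Am A) (h2 : Estimate02Le c γ L z Am A) :
    D.Estimate06Le r₀ (2 * Real.exp (4 * γ) * c) γ L z Am A :=
  have hLpos : 0 < L := (latLen_pos r₀).trans_le hL
  estimate06Le_of_estimate02Le hA hγ hL (fun s _ p => h114 A _ _ hA (h1.bound hγ hLpos) (h2.bound hγ hLpos) s p) h2

/-- «0.3 ⇒ 0.7 using (1.14)» with (1.14) supplied by the typed `PlaquetteAssignmentsEq114` and the bounds (2.3)–(2.4) by
Estimates 0.1–0.2. [cite: Federbush1986PhaseCellI, §4 p. 329; (1.13)–(1.14) p. 324] -/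
theorem estimate07Le_of_eq114_of_estimate03Le (h114 : D.PlaquetteAssignmentsEq114) {r₀ : ℕ} {c γ L : ℝ}
    {cε : ℝ → ℝ} {z : E4} {Am : ℝ} {A : E4 → Fin 4 → ℝ} (hA : ContDiff ℝ 1 A) (hγ : 0 ≤ γ) (hL : latLen r₀ ≤ L)
    (h1 : Estimate01Le c γ L z Am A) (h2 : Estimate02Le c γ L z Am A) (h3 : Estimate03Le c γ L cε z Am A) :
    D.Estimate07Le r₀ c γ L (fun ε => 2 * Real.exp (4 * γ) * cε ε) z Am A :=
  have hLpos : 0 < L := (latLen_pos r₀).trans_le hL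
  estimate07Le_of_estimate03Le hA hγ hL (fun s _ p => h114 A _ _ hA (h1.bound hγ hLpos) (h2.bound hγ hLpos) s p) h3

/-- **(4.1)** «By (2.13) and (3.13) we have |A^N(e)| < ce^{−γd(e,0)}. (4.1)» (READING `≤`; `e` at level 0, `d(e,0)` measured
from the base vertex): for every field with the decay package (3.13)–(3.15) and every carrier obeying (2.13).
[cite: Federbush1986PhaseCellI, (4.1) p. 329; (2.13) p. 326; (3.13) p. 328] -/
theorem eq41_of_eq213_of_decay (h213 : D.Eq213) {AN : E4 → Fin 4 → ℝ} (hAN : Decay313to315 AN) :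
    ∃ c γ : ℝ, 0 < γ ∧ ∀ e : Edge 0, |D.bond 0 AN e| ≤ c * Real.exp (-γ * dist e.src 0) := by
  obtain ⟨c, hc, γ, hγ, cε, hC1, h313, h314, -⟩ := hAN
  have h1 : Estimate01Le c γ 1 0 1 AN := estimate01Le_of_decay313 h313
  have h2 : Estimate02Le c γ 1 0 1 AN := estimate02Le_of_decay314 h314
  obtain ⟨c', -, H⟩ := estimate04Le_of_eq213 h213 hγ.le
  have hL : latLen 0 ≤ 1 := by simp [latLen]
  have h4 := H 0 c 1 0 1 AN _ _ hC1 (h1.bound hγ.le one_pos) (h2.bound hγ.le one_pos) hL h1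
  refine ⟨c' * c, γ, hγ, fun e => ?_⟩
  have h' := h4 0 le_rfl e
  simpa [latLen] using h'
/-! ## §3 Port for the fold owner's row F1.Sect§4 theorem: the `≤` Estimates 0.1–0.2 suffice -/

/-- A `≤`-Estimate 0.1 gives a STRICT Estimate 0.1 with amplitude `1` and constant `c|A(m)| + 1` (`L > 0`): the typed
strict rows are usable as HYPOTHESES from the `≤` readings. [cite: Federbush1986PhaseCellI, Estimate 0.1 (0.2) p. 320] -/
theorem Estimate01Le.strict {c γ L : ℝ} {z : E4} {Am : ℝ} {A : E4 → Fin 4 → ℝ} (h : Estimate01Le c γ L z Am A)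
    (hL : 0 < L) : Estimate01 (c * Am + 1) γ L z 1 A := by
  intro x μ
  have hpos : 0 < 1 / L * Real.exp (-γ * dist x z / L) := by positivity
  have hx := h x μ
  nlinarith

/-- A `≤`-Estimate 0.2 gives a STRICT Estimate 0.2 with amplitude `1` and constant `c|A(m)| + 1` (`L > 0`).
[cite: Federbush1986PhaseCellI, Estimate 0.2 (0.3) p. 320] -/
theorem Estimate02Le.strict {c γ L : ℝ} {z : E4} {Am : ℝ} {A : E4 → Fin 4 → ℝ} (h : Estimate02Le c γ L z Am A)
    (hL : 0 < L) : Estimate02 (c * Am + 1) γ L z 1 A := by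
  intro x ν μ
  have hpos : 0 < Real.exp (-γ * dist x z / L) / L ^ 2 := by positivity
  have hx := h x ν μ
  have e1 : c / L ^ 2 * Real.exp (-γ * dist x z / L) * Am = c * Am * (Real.exp (-γ * dist x z / L) / L ^ 2) := by ring
  rw [show (c * Am + 1) / L ^ 2 * Real.exp (-γ * dist x z / L) * 1 = c * Am * (Real.exp (-γ * dist x z / L) / L ^ 2)
    + Real.exp (-γ * dist x z / L) / L ^ 2 by ring]
  rw [e1] at hx; linarith

end AbelianAveraging

/-- **Row F1.Sect§4 for print's modes from the `≤` readings** (requested by the fold owner): r17's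
`axialTreeAveraging_latticeActionsConverge_of_estimates` with the `≤`-Estimates 0.1–0.2 as hypotheses — «the lattice
actions S^r_0 approach the continuum action as r → ∞» for every `C¹` potential obeying (0.2)–(0.3) read with `≤`.
[cite: Federbush1986PhaseCellI, §4 p. 329; Estimates 0.1–0.2 (0.2)–(0.3) p. 320] -/
theorem axialTreeAveraging_latticeActionsConverge_of_estimatesLe {A : E4 → Fin 4 → ℝ} (hA : ContDiff ℝ 1 A)
    {c γ L : ℝ} (hγ : 0 < γ) (hL : 0 < L) {z : E4} {Am : ℝ} (h1 : AbelianAveraging.Estimate01Le c γ L z Am A)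
    (h2 : AbelianAveraging.Estimate02Le c γ L z Am A) :
    (∀ s, Summable (AbelianAveraging.plaqTerm s (axialTreeAveraging.bond s A))) ∧
      Tendsto (fun s => ENNReal.ofReal (AbelianAveraging.latticeAction s (axialTreeAveraging.bond s A))) atTop
        (nhds (contAction A)) :=
  axialTreeAveraging_latticeActionsConverge_of_estimates hA hγ hL (h1.strict hL) (h2.strict hL)

end Literature.MathematicalPhysics.QuantumFieldTheory.Federbush1986
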